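import Mathlib.AlgebraicGeometry.EllipticCurve.Reduction
import Mathlib.AlgebraicGeometry.EllipticCurve.Affine.Point
import Mathlib.NumberTheory.NumberField.Completion.FinitePlace
import Mathlib.NumberTheory.NumberField.Basic
import Mathlib.Data.ZMod.Basic
import HarnessLib

-- provenance: harness21/H21/H21/Prelude/TranscendEllArithS/GlobalMinimalModel.lean @ 76e3a6b (interim HEAD d8f2665); M5 mechanical rewrite
/-!
# Global minimal Weierstrass models and point counts modulo `p`

Trunk T-ELLARITH (group G06 TranscendEllArithS, outline item C12, notion `global_minimal_model`).

Mathlib (`Mathlib.AlgebraicGeometry.EllipticCurve.Reduction`) provides the *local* theory: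
`WeierstrassCurve.IsIntegral R W` (coefficients in `R`), `WeierstrassCurve.integralModel`,
and `WeierstrassCurve.IsMinimal R W` for a discrete valuation ring `R` with fraction field `K`.
This file globalises these notions over a number field `K`:

* `WeierstrassCurve.IsGloballyMinimal W`: `W` is integral over `𝓞 K` and minimal at every finite
  place `v` (i.e. after base change to the completion `K_v`, minimal with respect to `𝓞_{K_v}`);
* `WeierstrassCurve.HasGlobalMinimalModel W`: some `K`-isomorphic equation is globally minimal;
* over `ℚ`: the integral model `WeierstrassCurve.integralModelInt W : WeierstrassCurve ℤ` of a globally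
  minimal `W`, its discriminant `WeierstrassCurve.minimalDiscriminantInt W`, and the point counts
  `WeierstrassCurve.reductionPointCount W p` and traces `WeierstrassCurve.frobeniusTrace W p` of the
  reduction modulo a prime `p` (shared by the BSD statement files and the quadratic-twist prelude).

Named facts (`def … : Prop`, cited): existence of global minimal models over `ℚ` and over number
fields of class number one (Néron; Silverman, *The Arithmetic of Elliptic Curves*, VIII.8.2–8.3),
uniqueness of the global minimal model over `ℚ` up to `u = ±1`, `r, s, t ∈ ℤ` (discharged at the end of
this file as `WeierstrassCurve.isGloballyMinimal_unique_holds`, Silverman VII.1.3(b)), and (proved)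
non-vanishing of the minimal discriminant.

## Design notes

* Group rule (outline §0): `noncomputable section`, `open scoped Classical`, no `[DecidableEq K]`.
* Declarations are deliberately placed in Mathlib's `WeierstrassCurve` namespace (dot-notation
  extensions of Mathlib's `IsIntegral` / `IsMinimal` API), as fixed by the outline.
* Mathlib's `WeierstrassCurve.Affine.Point` for a possibly *singular* Weierstrass equation consists
  of the nonsingular affine points together with the point at infinity, i.e. it is the group
  `Ẽ_ns(𝔽_p)` (with `O`). So at a prime of bad reduction `reductionPointCount W p = #Ẽ_ns(𝔽_p)`,
  which is `p - a_p` with `a_p ∈ {1, -1, 0}` the `L`-series coefficient at a split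
  multiplicative / non-split multiplicative / additive prime (`Ẽ_ns(𝔽_p)` is `𝔽_p^×`, the
  norm-one torus of order `p + 1`, or `𝔽_p^+`; Silverman, *AEC* III.2.5, VII.5). This is exactly
  the convention `N_p = #E_ns(𝔽_p)` of Conrad (2005, display (1.1): `N_p / p` is the reciprocal of
  the `p`-th Euler factor at `s = 1`) and of Kuo–Murty used in the Goldfeld-type BSD statements.
  Consequently the tree's `frobeniusTrace W p = p + 1 - N_p` equals `1 + a_p`, i.e. `2`, `0`, `1`
  at a split multiplicative / non-split multiplicative / additive prime — NOT the `L`-series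
  coefficient there (tree theorems `frobeniusTrace_eq_two_of_split` and
  `frobeniusTrace_eq_zero_of_nonsplit` in
  `Summits/BirchSwinnertonDyer/Rank1Residual/X11b/FrobeniusTraceMultiplicative.lean`); every
  consumer of `frobeniusTrace W p` as `a_p(E)` in the tree carries a good-reduction hypothesis
  at `p`.

## References

* J. H. Silverman, *The Arithmetic of Elliptic Curves*, GTM 106, 2nd ed. (2009), VII.1, VIII.8.
* A. Néron, *Modèles minimaux des variétés abéliennes sur les corps locaux et globaux*,
  Publ. Math. IHÉS 21 (1964).
* K. Conrad, *Partial Euler products on the critical line*, Canad. J. Math. 57 (2005).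
* W. Kuo, M. R. Murty, *On a conjecture of Birch and Swinnerton-Dyer*, Canad. J. Math. 57 (2005).
-/

noncomputable section

open scoped Classical
open NumberField IsDedekindDomain

/-! The declarations below extend Mathlib's `WeierstrassCurve` namespace (dot notation on `W`). -/
namespace WeierstrassCurve

section NumberField

variable {K : Type*} [Field K] [NumberField K]

/-- A Weierstrass equation `W` over a number field `K` is *globally minimal* if it has coefficients
in `𝓞 K` and, for every finite place `v` of `K`, its base change to the completion `K_v` is a minimal
Weierstrass equation with respect to the valuation ring `𝓞_{K_v}` (Silverman, *AEC* VIII.8, definition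
before Prop. 8.2). The field `isIntegral` is implied by `isMinimal` at all `v` (integrality over the
Dedekind domain `𝓞 K` is a local condition); it is kept as a redundant convenience field. [folklore] -/
class IsGloballyMinimal (W : WeierstrassCurve K) : Prop where
  /-- The coefficients of `W` lie in `𝓞 K`. -/
  isIntegral : W.IsIntegral (𝓞 K)
  /-- `W` is a minimal Weierstrass equation at every finite place `v`. -/
  isMinimal : ∀ v : HeightOneSpectrum (𝓞 K),
    (W.baseChange (v.adicCompletion K)).IsMinimal (v.adicCompletionIntegers K)

attribute [instance] IsGloballyMinimal.isIntegral

/-- A Weierstrass equation `W` over a number field `K` *has a global minimal model* if some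
`K`-isomorphic equation `C • W` is globally minimal (Silverman, *AEC* VIII.8). [folklore] -/
def HasGlobalMinimalModel (W : WeierstrassCurve K) : Prop :=
  ∃ C : VariableChange K, (C • W).IsGloballyMinimal

/-- Over a number field of class number one every Weierstrass equation has a global minimal model
(Silverman, *AEC* VIII.8.3 and Cor. 8.3). [cite: SilvermanAEC2009, VIII.8.2 and Cor. VIII.8.3] -/
def hasGlobalMinimalModel_of_isPrincipalIdealRing : Prop :=
  ∀ [IsPrincipalIdealRing (𝓞 K)] (W : WeierstrassCurve K) [W.IsElliptic],
    W.HasGlobalMinimalModel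

/-- The (global minimal) discriminant of a globally minimal Weierstrass equation of an elliptic
curve, i.e. the discriminant of its integral model over `𝓞 K`, is a nonzero algebraic integer
(Silverman, *AEC* VIII.8, "minimal discriminant"; immediate from `IsElliptic`). [folklore] -/
theorem IsGloballyMinimal.Δ_ne_zero (W : WeierstrassCurve K) [W.IsElliptic] [W.IsGloballyMinimal] :
    (W.integralModel (𝓞 K)).Δ ≠ 0 := by
  intro h
  have h' := integralModel_Δ_eq (𝓞 K) W
  rw [h, map_zero, ← coe_Δ'] at h'
  exact W.Δ'.ne_zero h'.symm

end NumberField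

section Rat

/-- Every Weierstrass equation of an elliptic curve over `ℚ` has a global minimal model
(Néron 1964; Silverman, *AEC* VIII.8.3, since `ℤ` is a principal ideal domain). [cite: Neron1964] -/
def hasGlobalMinimalModel_rat : Prop :=
  ∀ (W : WeierstrassCurve ℚ) [W.IsElliptic],
    W.HasGlobalMinimalModel

/-- The integral model over `ℤ` of a globally minimal Weierstrass equation over `ℚ`: Mathlib's
`integralModel (𝓞 ℚ) W` transported along `Rat.ringOfIntegersEquiv : 𝓞 ℚ ≃+* ℤ`
(Silverman, *AEC* VIII.8). It is characterised by `map_integralModelInt`. [folklore] -/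
def integralModelInt (W : WeierstrassCurve ℚ) [W.IsGloballyMinimal] : WeierstrassCurve ℤ :=
  (W.integralModel (𝓞 ℚ)).map Rat.ringOfIntegersEquiv.toRingHom

/-- The integral model `integralModelInt W` reduces to `W` under `ℤ → ℚ`; since `ℤ → ℚ` is injective
this determines `integralModelInt W` uniquely (Silverman, *AEC* VIII.8). [folklore] -/
@[simp]
theorem map_integralModelInt (W : WeierstrassCurve ℚ) [W.IsGloballyMinimal] :
    (integralModelInt W).map (Int.castRingHom ℚ) = W := by
  rw [integralModelInt, map_map]
  have : (Int.castRingHom ℚ).comp Rat.ringOfIntegersEquiv.toRingHom = algebraMap (𝓞 ℚ) ℚ := by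
    ext z
    simp [Rat.ringOfIntegersEquiv_apply_coe]
  rw [this]
  exact baseChange_integralModel_eq (𝓞 ℚ) W

/-- The *minimal discriminant* of a globally minimal Weierstrass equation over `ℚ`: the discriminant
of its integral model over `ℤ` (Silverman, *AEC* VIII.8, "minimal discriminant"). [folklore] -/
def minimalDiscriminantInt (W : WeierstrassCurve ℚ) [W.IsGloballyMinimal] : ℤ :=
  (integralModelInt W).Δ

/-- The minimal discriminant maps to `W.Δ` in `ℚ`. [folklore] -/
@[simp]
theorem cast_minimalDiscriminantInt (W : WeierstrassCurve ℚ) [W.IsGloballyMinimal] :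
    (minimalDiscriminantInt W : ℚ) = W.Δ := by
  have h := (integralModelInt W).map_Δ (Int.castRingHom ℚ)
  rw [map_integralModelInt, eq_intCast] at h
  exact h.symm

/-- The minimal discriminant of an elliptic curve over `ℚ` is nonzero (Silverman, *AEC* VIII.8). [folklore] -/
theorem minimalDiscriminantInt_ne_zero (W : WeierstrassCurve ℚ) [W.IsElliptic] [W.IsGloballyMinimal] :
    minimalDiscriminantInt W ≠ 0 := by
  intro h
  have h' := cast_minimalDiscriminantInt W
  rw [h, Int.cast_zero, ← coe_Δ'] at h'
  exact W.Δ'.ne_zero h'.symm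

/-- Uniqueness of the global minimal model over `ℚ`: if `W` and `C • W` are both globally minimal
Weierstrass equations of an elliptic curve over `ℚ`, then `C.u = ±1` and `r, s, t ∈ ℤ`
(Silverman, *AEC* VII.1.3(b) at every prime, together with `ℤˣ = {±1}`; cf. VIII.8.3). [cite: SilvermanAEC2009, VII.1.3(b) and VIII.8.3] -/
def isGloballyMinimal_unique : Prop :=
  ∀ (W : WeierstrassCurve ℚ) [W.IsElliptic] [W.IsGloballyMinimal] (C : VariableChange ℚ) [(C • W).IsGloballyMinimal],
    (C.u = 1 ∨ C.u = -1) ∧ ∃ r s t : ℤ, C.r = r ∧ C.s = s ∧ C.t = t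

/-- The minimal discriminant over `ℚ` does not depend on the choice of global minimal model: two
globally minimal models differ by `u = ±1`, and `Δ` scales by `u⁻¹²` (Silverman, *AEC* VIII.8,
Remark after 8.3). [cite: SilvermanAEC2009, VIII.8 (remark after Cor. 8.3)] -/
def minimalDiscriminantInt_smul_eq : Prop :=
  ∀ (W : WeierstrassCurve ℚ) [W.IsElliptic] [W.IsGloballyMinimal] (C : VariableChange ℚ) [(C • W).IsGloballyMinimal],
    minimalDiscriminantInt (C • W) = minimalDiscriminantInt W

/-! ### Point counts of the reduction modulo `p` -/

/-- The number of `𝔽_p`-points of the reduction modulo `p` of a globally minimal Weierstrass equation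
`W` over `ℚ`: `Nat.card` of Mathlib's type of points of `integralModelInt W` reduced modulo `p`.
Mathlib's `WeierstrassCurve.Affine.Point` of a possibly singular Weierstrass curve consists of the
*nonsingular* affine points plus the point at infinity `O`, i.e. it is the group `Ẽ_ns(𝔽_p)`.
Hence at a prime `p` of good reduction `reductionPointCount W p = #Ẽ(𝔽_p) = p + 1 - a_p`, while at
a prime of bad reduction `reductionPointCount W p = #Ẽ_ns(𝔽_p) = p - a_p` with `a_p ∈ {1, -1, 0}`
the `L`-series coefficient at a split multiplicative / non-split multiplicative / additive prime
(`Ẽ_ns(𝔽_p)` is `𝔽_p^×`, the norm-one torus of order `p + 1`, or `𝔽_p^+`; Silverman, *AEC*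
III.2.5, VII.5) — exactly the convention `N_p = #E_ns(𝔽_p)` of Conrad (2005, display (1.1):
`N_p / p` is the reciprocal of the `p`-th Euler factor of `L(E, s)` at `s = 1`) and Kuo–Murty
(2005). For `p = 0` (`ZMod 0 = ℤ`) this is the junk value `Nat.card` of the integral points.
(Silverman, *AEC* VII.2, V.2.) [cite: Conrad2005, §1 (1.1)] -/
def reductionPointCount (W : WeierstrassCurve ℚ) [W.IsGloballyMinimal] (p : ℕ) : ℕ :=
  Nat.card ((integralModelInt W).map (Int.castRingHom (ZMod p))).toAffine.Point

/-- The *trace of Frobenius* `a_p = p + 1 - N_p` of a globally minimal Weierstrass equation over `ℚ`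
at `p`, with `N_p = reductionPointCount W p` (Silverman, *AEC* V.2). At a prime of GOOD reduction
this is the `L`-series coefficient `a_p(E)`. At a BAD prime `N_p = #Ẽ_ns(𝔽_p) = p - a_p`
(see `reductionPointCount`), so this quantity equals `1 + a_p`: `2` at a split multiplicative, `0`
at a non-split multiplicative and `1` at an additive prime — not the `L`-series coefficient
`a_p ∈ {1, -1, 0}` (tree theorems `frobeniusTrace_eq_two_of_split`,
`frobeniusTrace_eq_zero_of_nonsplit`). Consumers that read `frobeniusTrace W p` as `a_p(E)` must
(and in the tree do) assume good reduction at `p`. [folklore] -/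
def frobeniusTrace (W : WeierstrassCurve ℚ) [W.IsGloballyMinimal] (p : ℕ) : ℤ :=
  (p : ℤ) + 1 - reductionPointCount W p

/-- The set of points of the reduction modulo a nonzero `p` is finite (it injects into
`Option (ZMod p × ZMod p)`). [folklore] -/
instance finite_point_reduction (W : WeierstrassCurve ℚ) [W.IsGloballyMinimal] (p : ℕ) [NeZero p] :
    Finite ((integralModelInt W).map (Int.castRingHom (ZMod p))).toAffine.Point := by
  refine Finite.of_injective
    (fun P : ((integralModelInt W).map (Int.castRingHom (ZMod p))).toAffine.Point =>
      match P with
      | .zero => (none : Option (ZMod p × ZMod p))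
      | .some x y _ => some (x, y)) ?_
  rintro (_ | ⟨x, y, _⟩) (_ | ⟨x', y', _⟩) h
  · rfl
  · simp at h
  · simp at h
  · simp only [Option.some.injEq, Prod.mk.injEq] at h
    obtain ⟨rfl, rfl⟩ := h
    rfl

/-- The reduction modulo a nonzero `p` has at least one point, namely `O`. [folklore] -/
theorem reductionPointCount_pos (W : WeierstrassCurve ℚ) [W.IsGloballyMinimal] (p : ℕ) [NeZero p] :
    0 < reductionPointCount W p :=
  haveI : Nonempty ((integralModelInt W).map (Int.castRingHom (ZMod p))).toAffine.Point := ⟨.zero⟩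
  Nat.card_pos

end Rat

end WeierstrassCurve

end

/-! ## Discharge of `isGloballyMinimal_unique` (Silverman, *AEC* VII.1.3(b))

Proof architecture, following Silverman, *The Arithmetic of Elliptic Curves*, 2nd ed., Prop. VII.1.3(b)
and its proof (p. 186): if `W` and `W' = C • W` are both minimal at a discrete valuation `v`, then
`v(Δ) = v(Δ')` by the definition of minimality, and `u¹² Δ' = Δ` gives `v(u) = 0`; over a number field
this holds at every finite place, so `u, u⁻¹ ∈ 𝓞 K`, i.e. `u ∈ (𝓞 K)ˣ`, and over `ℚ` this is `u = ±1`.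
Then (both equations having integral coefficients) the transformation formula for `b₆` (resp. `b₈`)
shows that `4r` (resp. `3r`) is a root of a monic integral cubic (resp. quartic), hence `r ∈ ℤ` by the
rational root theorem; the formula for `a₂` gives `s ∈ ℤ` and the formula for `a₆` gives `t ∈ ℤ`.
[cite: SilvermanAEC2009, Prop. VII.1.3(b), p. 186] -/

noncomputable section

open scoped Classical
open NumberField IsDedekindDomain

namespace WeierstrassCurve

section LocalStep

variable (R : Type*) [CommRing R] [IsDomain R] [IsDiscreteValuationRing R]
variable {K : Type*} [Field K] [Algebra R K] [IsFractionRing R K]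

open IsDiscreteValuationRing IsDedekindDomain.HeightOneSpectrum

/-- If `W` and `C • W` are both minimal and `Δ ≠ 0`, then `v(u) = 0`, i.e. the multiplicative valuation
of `C.u` is `1` (Silverman, *AEC* VII.1.3(b): "from the definition of minimality, `v(Δ') = v(Δ)` …
`u¹²Δ' = Δ`, so we see that `u ∈ R*`"). The first step `v(Δ') = v(Δ)` is proved inline; it is also
available as `WeierstrassCurve.valuation_Δ_smul_eq_of_isMinimal` in
`Literature.NumberTheory.DiophantineGeometry.LocalReductionProofs`.
[cite: SilvermanAEC2009, proof of Prop. VII.1.3(b), p. 186] -/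
theorem valuation_u_eq_one_of_isMinimal (W : WeierstrassCurve K) (C : VariableChange K)
    (hΔ : W.Δ ≠ 0) [hW : IsMinimal R W] [hC : IsMinimal R (C • W)] :
    valuation K (maximalIdeal R) (C.u : K) = 1 := by
  -- Step 1: `v(Δ') = v(Δ)` from the definition of minimality (each valuation bounds the other).
  have h : valuation K (maximalIdeal R) (C • W).Δ = valuation K (maximalIdeal R) W.Δ := by
    have h1 := hW.val_Δ_maximal.2 (j := C) (by simpa using (inferInstance : IsIntegral R (C • W)))
    have h2 := hC.val_Δ_maximal.2 (j := C⁻¹)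
      (by simpa [smul_smul] using (inferInstance : IsIntegral R W))
    simp only [one_smul, smul_smul, inv_mul_cancel, one_mul] at h1 h2
    have key : valuation_Δ_aux R (C • W) = valuation_Δ_aux R W := by
      rcases le_total (valuation_Δ_aux R W) (valuation_Δ_aux R (C • W)) with h | h
      · exact le_antisymm (h1 h) h
      · exact le_antisymm h (h2 h)
    have := congrArg Subtype.val key
    rwa [valuation_Δ_aux_eq_of_isIntegral, valuation_Δ_aux_eq_of_isIntegral] at this
  -- Step 2: `Δ' = u⁻¹² Δ` with `Δ ≠ 0` forces `v(u)¹² = 1`, hence `v(u) = 1`.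
  rw [variableChange_Δ, map_mul, map_pow, Units.val_inv_eq_inv_val, map_inv₀] at h
  have hΔ' : valuation K (maximalIdeal R) W.Δ ≠ 0 := by simpa using hΔ
  have h12 : (valuation K (maximalIdeal R) (C.u : K))⁻¹ ^ 12 = 1 :=
    mul_right_cancel₀ hΔ' (h.trans (one_mul _).symm)
  have := (pow_eq_one_iff_of_nonneg zero_le (by norm_num)).mp h12
  rwa [inv_eq_one] at this

/-- If `W` and `C • W` are both minimal and `Δ ≠ 0`, then `u` and `u⁻¹` lie in the valuation ring `R`
(Silverman, *AEC* VII.1.3(b): `u ∈ R*`). [cite: SilvermanAEC2009, Prop. VII.1.3(b)] -/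
theorem exists_algebraMap_eq_u_of_isMinimal (W : WeierstrassCurve K) (C : VariableChange K)
    (hΔ : W.Δ ≠ 0) [IsMinimal R W] [IsMinimal R (C • W)] :
    (∃ a : R, algebraMap R K a = C.u) ∧ (∃ a : R, algebraMap R K a = ↑C.u⁻¹) := by
  have h := valuation_u_eq_one_of_isMinimal R W C hΔ
  refine ⟨exists_lift_of_le_one h.le, exists_lift_of_le_one ?_⟩
  rw [Units.val_inv_eq_inv_val, map_inv₀, h, inv_one]

end LocalStep

section NumberFieldStep

variable {K : Type*} [Field K] [NumberField K]

/-- If `W` and `C • W` are globally minimal Weierstrass equations of an elliptic curve over a number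
field `K`, then `v(u) ≤ 1` and `v(u⁻¹) ≤ 1` at every finite place `v` (Silverman, *AEC* VII.1.3(b)
applied at each `v`). [cite: SilvermanAEC2009, Prop. VII.1.3(b)] -/
theorem IsGloballyMinimal.valuation_u_le_one (W : WeierstrassCurve K) [W.IsElliptic]
    [hW : W.IsGloballyMinimal] (C : VariableChange K) [hC : (C • W).IsGloballyMinimal]
    (v : HeightOneSpectrum (𝓞 K)) :
    v.valuation K C.u ≤ 1 ∧ v.valuation K ↑C.u⁻¹ ≤ 1 := by
  haveI := hW.isMinimal v
  haveI : IsMinimal (v.adicCompletionIntegers K)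
      ((C.baseChange (v.adicCompletion K)) • (W.baseChange (v.adicCompletion K))) := by
    rw [VariableChange.baseChange, baseChange, map_variableChange]
    exact hC.isMinimal v
  have hΔ : (W.baseChange (v.adicCompletion K)).Δ ≠ 0 := by
    rw [baseChange, map_Δ]
    exact (map_ne_zero _).mpr W.isUnit_Δ.ne_zero
  obtain ⟨⟨a, ha⟩, ⟨b, hb⟩⟩ := exists_algebraMap_eq_u_of_isMinimal (v.adicCompletionIntegers K)
    (W.baseChange (v.adicCompletion K)) (C.baseChange (v.adicCompletion K)) hΔ
  rw [VariableChange.baseChange] at ha hb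
  rw [VariableChange.map_u, Units.coe_map, MonoidHom.coe_coe] at ha
  rw [VariableChange.map_u, Units.coe_map_inv, MonoidHom.coe_coe] at hb
  constructor
  · have h := a.2
    rw [HeightOneSpectrum.mem_adicCompletionIntegers, ← ValuationSubring.algebraMap_apply, ha] at h
    rwa [← HeightOneSpectrum.valuedAdicCompletion_eq_valuation']
  · have h := b.2
    rw [HeightOneSpectrum.mem_adicCompletionIntegers, ← ValuationSubring.algebraMap_apply, hb] at h
    rwa [← HeightOneSpectrum.valuedAdicCompletion_eq_valuation']

/-- If `W` and `C • W` are globally minimal Weierstrass equations of an elliptic curve over a number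
field `K`, then `u ∈ (𝓞 K)ˣ`, i.e. both `u` and `u⁻¹` lie in `𝓞 K` (Silverman, *AEC* VII.1.3(b) at
every finite place, plus `𝓞 K = ⋂ᵥ 𝓞_v ∩ K`). [cite: SilvermanAEC2009, Prop. VII.1.3(b); cf. VIII.8] -/
theorem IsGloballyMinimal.u_mem_range (W : WeierstrassCurve K) [W.IsElliptic]
    [W.IsGloballyMinimal] (C : VariableChange K) [(C • W).IsGloballyMinimal] :
    (C.u : K) ∈ (algebraMap (𝓞 K) K).range ∧ (↑C.u⁻¹ : K) ∈ (algebraMap (𝓞 K) K).range :=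
  ⟨HeightOneSpectrum.mem_integers_of_valuation_le_one K (C.u : K)
      (fun v => (IsGloballyMinimal.valuation_u_le_one W C v).1),
    HeightOneSpectrum.mem_integers_of_valuation_le_one K (↑C.u⁻¹ : K)
      (fun v => (IsGloballyMinimal.valuation_u_le_one W C v).2)⟩

end NumberFieldStep

section RatStep

open Polynomial

/-- Rational root theorem, monic quadratic over `ℤ`. [folklore] -/
private theorem exists_int_cast_eq_of_quadratic (x : ℚ) (a b : ℤ) (h : x ^ 2 + a * x + b = 0) :
    ∃ n : ℤ, (n : ℚ) = x := by
  obtain ⟨n, hn, -⟩ := exists_integer_of_is_root_of_monic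
    (p := X ^ 2 + Polynomial.C a * X + Polynomial.C b) (by monicity!) (r := x) (by simp [h])
  exact ⟨n, by simp [hn]⟩

/-- Rational root theorem, monic cubic over `ℤ`. [folklore] -/
private theorem exists_int_cast_eq_of_cubic (x : ℚ) (a b c : ℤ)
    (h : x ^ 3 + a * x ^ 2 + b * x + c = 0) : ∃ n : ℤ, (n : ℚ) = x := by
  obtain ⟨n, hn, -⟩ := exists_integer_of_is_root_of_monic
    (p := X ^ 3 + Polynomial.C a * X ^ 2 + Polynomial.C b * X + Polynomial.C c) (by monicity!)
    (r := x) (by simp [h])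
  exact ⟨n, by simp [hn]⟩

/-- Rational root theorem, monic quartic over `ℤ`. [folklore] -/
private theorem exists_int_cast_eq_of_quartic (x : ℚ) (a b c d : ℤ)
    (h : x ^ 4 + a * x ^ 3 + b * x ^ 2 + c * x + d = 0) : ∃ n : ℤ, (n : ℚ) = x := by
  obtain ⟨n, hn, -⟩ := exists_integer_of_is_root_of_monic
    (p := X ^ 4 + Polynomial.C a * X ^ 3 + Polynomial.C b * X ^ 2 + Polynomial.C c * X +
      Polynomial.C d) (by monicity!) (r := x) (by simp [h])
  exact ⟨n, by simp [hn]⟩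

/-- An element of `ℚ` in the image of `𝓞 ℚ` is (the cast of) an integer. [folklore] -/
private theorem exists_int_cast_eq_of_mem_range (x : ℚ) (h : x ∈ (algebraMap (𝓞 ℚ) ℚ).range) :
    ∃ n : ℤ, (n : ℚ) = x := by
  obtain ⟨y, rfl⟩ := h
  exact ⟨Rat.ringOfIntegersEquiv y, Rat.ringOfIntegersEquiv_apply_coe y⟩

/-- The quantities `a₁, …, a₆, b₂, …, b₈` of a Weierstrass equation over `ℚ` with coefficients in
`𝓞 ℚ` are integers. [folklore] -/
private theorem exists_int_cast_eq_of_isIntegral (W : WeierstrassCurve ℚ) [W.IsIntegral (𝓞 ℚ)] :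
    ∃ a₁ a₂ a₃ a₄ a₆ b₂ b₄ b₆ b₈ : ℤ, (a₁ : ℚ) = W.a₁ ∧ (a₂ : ℚ) = W.a₂ ∧ (a₃ : ℚ) = W.a₃ ∧
      (a₄ : ℚ) = W.a₄ ∧ (a₆ : ℚ) = W.a₆ ∧ (b₂ : ℚ) = W.b₂ ∧ (b₄ : ℚ) = W.b₄ ∧ (b₆ : ℚ) = W.b₆ ∧
      (b₈ : ℚ) = W.b₈ := by
  obtain ⟨a₁, ha₁⟩ := exists_int_cast_eq_of_mem_range W.a₁ ⟨_, integralModel_a₁_eq (𝓞 ℚ) W⟩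
  obtain ⟨a₂, ha₂⟩ := exists_int_cast_eq_of_mem_range W.a₂ ⟨_, integralModel_a₂_eq (𝓞 ℚ) W⟩
  obtain ⟨a₃, ha₃⟩ := exists_int_cast_eq_of_mem_range W.a₃ ⟨_, integralModel_a₃_eq (𝓞 ℚ) W⟩
  obtain ⟨a₄, ha₄⟩ := exists_int_cast_eq_of_mem_range W.a₄ ⟨_, integralModel_a₄_eq (𝓞 ℚ) W⟩
  obtain ⟨a₆, ha₆⟩ := exists_int_cast_eq_of_mem_range W.a₆ ⟨_, integralModel_a₆_eq (𝓞 ℚ) W⟩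
  obtain ⟨b₂, hb₂⟩ := exists_int_cast_eq_of_mem_range W.b₂ ⟨_, integralModel_b₂_eq (𝓞 ℚ) W⟩
  obtain ⟨b₄, hb₄⟩ := exists_int_cast_eq_of_mem_range W.b₄ ⟨_, integralModel_b₄_eq (𝓞 ℚ) W⟩
  obtain ⟨b₆, hb₆⟩ := exists_int_cast_eq_of_mem_range W.b₆ ⟨_, integralModel_b₆_eq (𝓞 ℚ) W⟩
  obtain ⟨b₈, hb₈⟩ := exists_int_cast_eq_of_mem_range W.b₈ ⟨_, integralModel_b₈_eq (𝓞 ℚ) W⟩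
  exact ⟨a₁, a₂, a₃, a₄, a₆, b₂, b₄, b₆, b₈, ha₁, ha₂, ha₃, ha₄, ha₆, hb₂, hb₄, hb₆, hb₈⟩

/-- The `r, s, t` part of Silverman, *AEC* VII.1.3(b) over `ℤ ⊆ ℚ`: if `W` and `C • W` both have
integral coefficients and `u = ±1` (used only through `u⁻² = 1`), then `r, s, t ∈ ℤ`. The `b₆`
(resp. `b₈`) transformation formula makes `4r` (resp. `3r`) a root of a monic integral cubic
(resp. quartic), so `r = 4r - 3r ∈ ℤ`; then the `a₂` formula is a monic integral quadratic in `s`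
and the `a₆` formula a monic integral quadratic in `t`.
[cite: SilvermanAEC2009, proof of Prop. VII.1.3(b), p. 186] -/
theorem exists_int_cast_eq_rst_of_isIntegral (W : WeierstrassCurve ℚ) [W.IsIntegral (𝓞 ℚ)]
    (C : VariableChange ℚ) [(C • W).IsIntegral (𝓞 ℚ)] (hu : (↑C.u⁻¹ : ℚ) ^ 2 = 1) :
    ∃ r s t : ℤ, C.r = r ∧ C.s = s ∧ C.t = t := by
  obtain ⟨a₁, a₂, a₃, a₄, a₆, b₂, b₄, b₆, b₈, ha₁, ha₂, ha₃, ha₄, ha₆, hb₂, hb₄, hb₆, hb₈⟩ :=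
    exists_int_cast_eq_of_isIntegral W
  obtain ⟨-, a₂', -, -, a₆', -, -, b₆', b₈', -, ha₂', -, -, ha₆', -, -, hb₆', hb₈'⟩ :=
    exists_int_cast_eq_of_isIntegral (C • W)
  have hu6 : (↑C.u⁻¹ : ℚ) ^ 6 = 1 := by rw [show 6 = 2 * 3 from rfl, pow_mul, hu, one_pow]
  have hu8 : (↑C.u⁻¹ : ℚ) ^ 8 = 1 := by rw [show 8 = 2 * 4 from rfl, pow_mul, hu, one_pow]
  rw [variableChange_b₆, hu6, one_mul, ← hb₂, ← hb₄, ← hb₆] at hb₆'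
  rw [variableChange_b₈, hu8, one_mul, ← hb₂, ← hb₄, ← hb₆, ← hb₈] at hb₈'
  rw [variableChange_a₂, hu, one_mul, ← ha₁, ← ha₂] at ha₂'
  rw [variableChange_a₆, hu6, one_mul, ← ha₁, ← ha₂, ← ha₃, ← ha₄, ← ha₆] at ha₆'
  -- `4r` and `3r` are integers, hence so is `r = 4r - 3r`
  obtain ⟨m, hm⟩ := exists_int_cast_eq_of_cubic (4 * C.r) b₂ (8 * b₄) (16 * (b₆ - b₆'))
    (by push_cast; linear_combination (-16) * hb₆')
  obtain ⟨n, hn⟩ := exists_int_cast_eq_of_quartic (3 * C.r) b₂ (9 * b₄) (27 * b₆)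
    (27 * (b₈ - b₈')) (by push_cast; linear_combination (-27) * hb₈')
  have hr : C.r = (m : ℚ) - n := by linear_combination hn - hm
  rw [hr] at ha₂' ha₆'
  obtain ⟨s, hs⟩ := exists_int_cast_eq_of_quadratic C.s a₁ (a₂' - a₂ - 3 * (m - n))
    (by push_cast; linear_combination ha₂')
  obtain ⟨t, ht⟩ := exists_int_cast_eq_of_quadratic C.t (a₃ + (m - n) * a₁)
    (a₆' - a₆ - (m - n) * a₄ - (m - n) ^ 2 * a₂ - (m - n) ^ 3)
    (by push_cast; linear_combination ha₆')
  exact ⟨m - n, s, t, by push_cast; exact hr, hs.symm, ht.symm⟩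

/-- **Discharge of `isGloballyMinimal_unique`** (uniqueness of the global minimal model over `ℚ` up to
`u = ±1`, `r, s, t ∈ ℤ`): Silverman, *AEC* Prop. VII.1.3(b) at every prime gives `u ∈ ℤₚˣ` for all
`p`, hence `u ∈ ℤˣ = {±1}`, and then `r, s, t ∈ ℤ` by `exists_int_cast_eq_rst_of_isIntegral`.
[cite: SilvermanAEC2009, Prop. VII.1.3(b), p. 186; cf. VIII.8.3] -/
theorem isGloballyMinimal_unique_holds : isGloballyMinimal_unique := by
  intro W _ _ C _
  obtain ⟨hu, hui⟩ := IsGloballyMinimal.u_mem_range W C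
  obtain ⟨U, hU⟩ := exists_int_cast_eq_of_mem_range (C.u : ℚ) hu
  obtain ⟨Ui, hUi⟩ := exists_int_cast_eq_of_mem_range (↑C.u⁻¹ : ℚ) hui
  have hUU : Ui * U = 1 := by
    exact_mod_cast (show (Ui : ℚ) * U = 1 by rw [hU, hUi, Units.inv_mul])
  refine ⟨?_, exists_int_cast_eq_rst_of_isIntegral W C ?_⟩
  · rcases Int.eq_one_or_neg_one_of_mul_eq_one' hUU with ⟨-, h⟩ | ⟨-, h⟩
    · left; ext; rw [← hU, h]; simp
    · right; ext; rw [← hU, h]; simp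
  · rw [← hUi]
    rcases Int.eq_one_or_neg_one_of_mul_eq_one hUU with h | h <;> simp [h]

end RatStep

end WeierstrassCurve

end
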